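import Literature.NumberTheory.Automorphic.UnitaryGroupTruncatedTracePolynomialOffBorel
import HarnessLib

/-!
# Glue: a row closer `J^T_𝔬(f) = A·log T + B` (`T ≫ 0`) identifies the socket's class polynomial as `p_𝔬 = A·X + B`,
# so `p_𝔬(0) = B`; summed over a finite set of classes
(Arthur, *The trace formula in invariant form*, Ann. of Math. 114 (1981), Prop. 2.3: `J^T_𝔬(f)` is a polynomial in
`log T` — here of degree `≤ 1` — and `J_𝔬(f)` is its constant term; Rogawski, *Automorphic Representations of Unitary
Groups in Three Variables* (1990), §2.2–2.3 pp. 13–14 and §6.1 (6.1.3), §7.2 (7.2.3), §7.3 (7.3.2): the three kinds of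
classes meeting `B(F)` each come with such a closed form; Shokranian (1992), Thm. (5.7), Rem. (5.8))

Topic `NumberTheory/Automorphic`; namespace `Literature.NumberTheory.Automorphic.UnitaryGroup`. THEOREMS ONLY over
accepted tree modules: no definition, no named fact, no instance, no notation, no `sorry`. (W-asm) STEP 4 «GLUE: ROW
CLOSER ⇒ SOCKET POLYNOMIAL» of the T1-qs LAW 5 road of `Cruxes/H413/Lines/F0_T1InnerFormTraceIdentity.lean` (cell
`pub/hodgecm-mathlib`, crux H413). PURE ALGEBRA over ★ (3d) `polynomial_eq_of_forall_eval_log_eq`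
(`UnitaryGroupTruncatedTracePolynomialOffBorel`: a complex polynomial is determined by its values at the points `log T`,
`T > T₀`). The LAW-3 closer ★ `UnitaryGroupTruncatedTracePolynomialExpansion` produces, for each class `𝔬` in a finite set
`S_f`, a polynomial `p_𝔬` with `J^T_𝔬(f) = p_𝔬(log T)` for `T > T₀`; each LAW-5 row closer ((σ-i) central ∕ unipotent,
(σ-ii) regular hyperbolic [Rogawski (6.1.3)], (σ-iii) singular in Borel [(7.2.3)]) produces `J^T_𝔬(f) = A_𝔬·log T + B_𝔬`
for `T > T₁`. This file says the obvious: `p_𝔬 = A_𝔬·X + B_𝔬`, hence `p_𝔬(0) = B_𝔬`, class by class and summed.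

* §1 (any function `J : ℝ≥0 → ℂ` — the letters are function-generic so that every row plugs in with
  `J := fun T => truncatedTraceClass μ ν 𝓕 T cl i f` or any other truncated functional)
  **`polynomial_eq_C_mul_X_add_C_of_forall_eval_log_eq`** — `(∀ T > T₀, J T = P(log T)) → (∀ T > T₁, J T = A·log T + B)
  → P = C A * X + C B`; **`polynomial_eval_zero_eq_of_forall_eval_log_eq`** — `… → P.eval 0 = B`;
  `polynomial_natDegree_le_one_of_forall_eval_log_eq`; the constant-row case (`A = 0`, central and off-`B(F)` classes)
  **`polynomial_eq_C_of_forall_eval_log_eq_const`** ∕ `polynomial_eval_zero_eq_of_forall_eval_log_eq_const`.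
* §2 (Finset form) **`sum_polynomial_eval_zero_eq_sum_of_forall_eval_log_eq`** — for a finite set `S` of indices with
  socket polynomials `P i` and row closers `(A i, B i)` (thresholds `T₀ i`, `T₁ i` may depend on `i`):
  `∑ i ∈ S, (P i).eval 0 = ∑ i ∈ S, B i`.
* §3 (the tree's letters) **`classPolynomial_eq_C_mul_X_add_C`**, **`classPolynomial_eval_zero_eq`**,
  **`sum_classPolynomial_eval_zero_eq`** — §1–§2 at `J := fun T => truncatedTraceClass μ ν 𝓕 T cl i f` (generic
  `F, E, c, N, cl, i`; NOT pinned), the shape in which the socket ★ `arthurTrace_eq_sum_offBorel_add_sum_charpoly_cm` ∕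
  ★ p821748 `UnitaryGroupArthurTraceThreeSockets` consume the row closers by name.

## References

* J. Arthur, *The trace formula in invariant form*, Ann. of Math. 114 (1981), Prop. 2.3
  [Arthur1981TraceFormulaInvariantForm].
* J. D. Rogawski, *Automorphic Representations of Unitary Groups in Three Variables*, Ann. of Math. Stud. 123 (1990),
  §2.2–2.3 (pp. 13–14), §6.1 (6.1.3), §7.2 (7.2.3), §7.3 (7.3.2) [Rogawski1990].
* S. Shokranian, *The Selberg–Arthur Trace Formula*, LNM 1503 (1992), Thm. (5.7), Rem. (5.8) [Shokranian1992].
-/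

set_option autoImplicit false

noncomputable section

open MeasureTheory Measure Set Polynomial
open scoped NNReal ENNReal

namespace Literature.NumberTheory.Automorphic

namespace UnitaryGroup

/-! ## §1 Function-generic glue: a closed form `A·log T + B` for `T ≫ 0` identifies the polynomial -/

section Generic

variable {J : ℝ≥0 → ℂ} {P : ℂ[X]} {T₀ T₁ : ℝ≥0} {A B : ℂ}

/-- **ROW CLOSER ⇒ SOCKET POLYNOMIAL.** If a function `J` of the truncation parameter is computed above a threshold by
a polynomial in `log T` (`J T = P(log T)` for `T > T₀`) and, above another threshold, by the closed form
`J T = A·log T + B` (`T > T₁`), then `P = A·X + B`: the two polynomials `P` and `C A * X + C B` agree at `log T` for every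
`T > max T₀ T₁` (★ `polynomial_eq_of_forall_eval_log_eq`). [cite: Arthur1981TraceFormulaInvariantForm, Prop. 2.3]
[cite: Shokranian1992, Thm. (5.7) and Rem. (5.8)] -/
theorem polynomial_eq_C_mul_X_add_C_of_forall_eval_log_eq
    (hP : ∀ T : ℝ≥0, T₀ < T → J T = P.eval ((Real.log (T : ℝ) : ℝ) : ℂ))
    (hrow : ∀ T : ℝ≥0, T₁ < T → J T = A * ((Real.log (T : ℝ) : ℝ) : ℂ) + B) :
    P = C A * X + C B := by
  refine polynomial_eq_of_forall_eval_log_eq (T₀ := max T₀ T₁) fun T hT => ?_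
  rw [← hP T (lt_of_le_of_lt (le_max_left _ _) hT), hrow T (lt_of_le_of_lt (le_max_right _ _) hT),
    eval_add, eval_mul, eval_C, eval_X, eval_C]

/-- Hence **the constant term is the row's constant**: `P.eval 0 = B` (`J_𝔬(f) := p_𝔬(0)`, [Arthur 1981, Prop. 2.3]).
[cite: Arthur1981TraceFormulaInvariantForm, Prop. 2.3] [cite: Rogawski1990, §2.2–2.3 (pp. 13–14)] -/
theorem polynomial_eval_zero_eq_of_forall_eval_log_eq
    (hP : ∀ T : ℝ≥0, T₀ < T → J T = P.eval ((Real.log (T : ℝ) : ℝ) : ℂ))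
    (hrow : ∀ T : ℝ≥0, T₁ < T → J T = A * ((Real.log (T : ℝ) : ℝ) : ℂ) + B) :
    P.eval 0 = B := by
  rw [polynomial_eq_C_mul_X_add_C_of_forall_eval_log_eq hP hrow, eval_add, eval_mul, eval_C, eval_X, eval_C,
    mul_zero, zero_add]

/-- And the leading coefficient is the row's slope: `P.coeff 1 = A` (the `log T`-coefficient, e.g. `2 c_μ C · Φ(γ, f)` for a
regular hyperbolic class [Rogawski (6.1.3)]). [cite: Arthur1981TraceFormulaInvariantForm, Prop. 2.3]
[cite: Rogawski1990, §6.1 (6.1.3)] -/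
theorem polynomial_coeff_one_eq_of_forall_eval_log_eq
    (hP : ∀ T : ℝ≥0, T₀ < T → J T = P.eval ((Real.log (T : ℝ) : ℝ) : ℂ))
    (hrow : ∀ T : ℝ≥0, T₁ < T → J T = A * ((Real.log (T : ℝ) : ℝ) : ℂ) + B) :
    P.coeff 1 = A := by
  rw [polynomial_eq_C_mul_X_add_C_of_forall_eval_log_eq hP hrow, coeff_add, coeff_C_mul, coeff_X_one, coeff_C,
    if_neg one_ne_zero, mul_one, add_zero]

/-- Such a polynomial has degree `≤ 1`. [cite: Arthur1981TraceFormulaInvariantForm, Prop. 2.3] -/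
theorem polynomial_natDegree_le_one_of_forall_eval_log_eq
    (hP : ∀ T : ℝ≥0, T₀ < T → J T = P.eval ((Real.log (T : ℝ) : ℝ) : ℂ))
    (hrow : ∀ T : ℝ≥0, T₁ < T → J T = A * ((Real.log (T : ℝ) : ℝ) : ℂ) + B) :
    P.natDegree ≤ 1 := by
  rw [polynomial_eq_C_mul_X_add_C_of_forall_eval_log_eq hP hrow]
  refine (natDegree_add_le _ _).trans (max_le ?_ ?_)
  · exact (natDegree_C_mul_le _ _).trans natDegree_X_le
  · rw [natDegree_C]; exact zero_le_one

/-- **CONSTANT ROW** (`A = 0`: the central classes, the classes missing `B(F)` — ★ (3d)'s case): if `J T = B` for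
`T > T₁` then `P = C B`. [cite: Arthur1981TraceFormulaInvariantForm, Prop. 2.3] [cite: Rogawski1990, §2.2 (p. 13)] -/
theorem polynomial_eq_C_of_forall_eval_log_eq_const
    (hP : ∀ T : ℝ≥0, T₀ < T → J T = P.eval ((Real.log (T : ℝ) : ℝ) : ℂ))
    (hrow : ∀ T : ℝ≥0, T₁ < T → J T = B) : P = C B := by
  have h := polynomial_eq_C_mul_X_add_C_of_forall_eval_log_eq (A := 0) hP (fun T hT => by rw [hrow T hT, zero_mul, zero_add])
  rw [h, map_zero, zero_mul, zero_add]

/-- Constant row, constant term: `P.eval 0 = B`. [cite: Arthur1981TraceFormulaInvariantForm, Prop. 2.3] -/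
theorem polynomial_eval_zero_eq_of_forall_eval_log_eq_const
    (hP : ∀ T : ℝ≥0, T₀ < T → J T = P.eval ((Real.log (T : ℝ) : ℝ) : ℂ))
    (hrow : ∀ T : ℝ≥0, T₁ < T → J T = B) : P.eval 0 = B := by
  rw [polynomial_eq_C_of_forall_eval_log_eq_const hP hrow, eval_C]

end Generic

/-! ## §2 Summed over a finite set of classes -/

section Sum

variable {κ : Type*} {J : κ → ℝ≥0 → ℂ} {P : κ → ℂ[X]} {T₀ T₁ : κ → ℝ≥0} {A B : κ → ℂ}

/-- **THE SOCKET SUM**: if for every index `i ∈ S` the socket polynomial `P i` computes `J i` above `T₀ i` and the row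
closer gives `J i T = A i · log T + B i` above `T₁ i`, then `∑ i ∈ S, (P i).eval 0 = ∑ i ∈ S, B i` (the constant term of
the fine `𝔬`-expansion restricted to `S`, [Rogawski §2.3: `J(f) = Σ_𝔬 J_𝔬(f)`]). [cite: Rogawski1990, §2.2–2.3 (pp. 13–14)]
[cite: Arthur1981TraceFormulaInvariantForm, Prop. 2.3] -/
theorem sum_polynomial_eval_zero_eq_sum_of_forall_eval_log_eq (S : Finset κ)
    (hP : ∀ i ∈ S, ∀ T : ℝ≥0, T₀ i < T → J i T = (P i).eval ((Real.log (T : ℝ) : ℝ) : ℂ))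
    (hrow : ∀ i ∈ S, ∀ T : ℝ≥0, T₁ i < T → J i T = A i * ((Real.log (T : ℝ) : ℝ) : ℂ) + B i) :
    ∑ i ∈ S, (P i).eval 0 = ∑ i ∈ S, B i :=
  Finset.sum_congr rfl fun i hi => polynomial_eval_zero_eq_of_forall_eval_log_eq (hP i hi) (hrow i hi)

/-- The socket sum with the slopes: `∑ i ∈ S, (P i).coeff 1 = ∑ i ∈ S, A i`. [cite: Arthur1981TraceFormulaInvariantForm, Prop. 2.3] -/
theorem sum_polynomial_coeff_one_eq_sum_of_forall_eval_log_eq (S : Finset κ)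
    (hP : ∀ i ∈ S, ∀ T : ℝ≥0, T₀ i < T → J i T = (P i).eval ((Real.log (T : ℝ) : ℝ) : ℂ))
    (hrow : ∀ i ∈ S, ∀ T : ℝ≥0, T₁ i < T → J i T = A i * ((Real.log (T : ℝ) : ℝ) : ℂ) + B i) :
    ∑ i ∈ S, (P i).coeff 1 = ∑ i ∈ S, A i :=
  Finset.sum_congr rfl fun i hi => polynomial_coeff_one_eq_of_forall_eval_log_eq (hP i hi) (hrow i hi)

end Sum

/-! ## §3 The tree's letters: `J := fun T => truncatedTraceClass μ ν 𝓕 T cl i f` -/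

section Class

variable {F E : Type} [Field F] [NumberField F] [Field E] [NumberField E] [Algebra F E]
  {c : E ≃ₐ[F] E} {N : ℕ} {ι : Type*} [NeZero N] [MeasurableSpace (adelicUnipotent F E c N)]
  {cl : (quasiSplit F E c N).arithmeticSubgroup → ι}
  {μ : Measure (quasiSplit F E c N).automorphicQuotient}
  {ν : Measure (adelicUnipotent F E c N)} {𝓕 : Set (adelicUnipotent F E c N)}
  {f : (quasiSplit F E c N).Adelic → ℂ}

/-- **ROW CLOSER ⇒ CLASS POLYNOMIAL** in the tree's letters: if `p_𝔬` computes `J^T_𝔬(f)` for `T > T₀` (the LAW-3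
closer's output) and a row closer gives `J^T_𝔬(f) = A·log T + B` for `T > T₁`, then `p_𝔬 = A·X + B`.
[cite: Arthur1981TraceFormulaInvariantForm, Prop. 2.3] [cite: Rogawski1990, §2.2–2.3 (pp. 13–14)] -/
theorem classPolynomial_eq_C_mul_X_add_C {i : ι} {P : ℂ[X]} {T₀ T₁ : ℝ≥0} {A B : ℂ}
    (hP : ∀ T : ℝ≥0, T₀ < T → truncatedTraceClass μ ν 𝓕 T cl i f = P.eval ((Real.log (T : ℝ) : ℝ) : ℂ))
    (hrow : ∀ T : ℝ≥0, T₁ < T → truncatedTraceClass μ ν 𝓕 T cl i f = A * ((Real.log (T : ℝ) : ℝ) : ℂ) + B) :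
    P = C A * X + C B :=
  polynomial_eq_C_mul_X_add_C_of_forall_eval_log_eq (J := fun T => truncatedTraceClass μ ν 𝓕 T cl i f) hP hrow

/-- `J_𝔬(f) := p_𝔬(0) = B`. [cite: Arthur1981TraceFormulaInvariantForm, Prop. 2.3] [cite: Rogawski1990, §2.2–2.3 (pp. 13–14)] -/
theorem classPolynomial_eval_zero_eq {i : ι} {P : ℂ[X]} {T₀ T₁ : ℝ≥0} {A B : ℂ}
    (hP : ∀ T : ℝ≥0, T₀ < T → truncatedTraceClass μ ν 𝓕 T cl i f = P.eval ((Real.log (T : ℝ) : ℝ) : ℂ))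
    (hrow : ∀ T : ℝ≥0, T₁ < T → truncatedTraceClass μ ν 𝓕 T cl i f = A * ((Real.log (T : ℝ) : ℝ) : ℂ) + B) :
    P.eval 0 = B :=
  polynomial_eval_zero_eq_of_forall_eval_log_eq (J := fun T => truncatedTraceClass μ ν 𝓕 T cl i f) hP hrow

/-- Constant row (`A = 0`): `p_𝔬 = C B` and `p_𝔬(0) = B`. [cite: Arthur1981TraceFormulaInvariantForm, Prop. 2.3] -/
theorem classPolynomial_eq_C_of_const {i : ι} {P : ℂ[X]} {T₀ T₁ : ℝ≥0} {B : ℂ}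
    (hP : ∀ T : ℝ≥0, T₀ < T → truncatedTraceClass μ ν 𝓕 T cl i f = P.eval ((Real.log (T : ℝ) : ℝ) : ℂ))
    (hrow : ∀ T : ℝ≥0, T₁ < T → truncatedTraceClass μ ν 𝓕 T cl i f = B) :
    P = C B ∧ P.eval 0 = B :=
  ⟨polynomial_eq_C_of_forall_eval_log_eq_const (J := fun T => truncatedTraceClass μ ν 𝓕 T cl i f) hP hrow,
    polynomial_eval_zero_eq_of_forall_eval_log_eq_const (J := fun T => truncatedTraceClass μ ν 𝓕 T cl i f) hP hrow⟩

/-- **THE SOCKET SUM in the tree's letters**: over a finite set `S` of classes (e.g. `S'.attach` for a filter `S'` of the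
LAW-3 closer's `S_f`) with socket polynomials `P` and row closers `(A, B)`:
`∑ i ∈ S, (P i).eval 0 = ∑ i ∈ S, B i`. [cite: Rogawski1990, §2.2–2.3 (pp. 13–14)] [cite: Arthur1981TraceFormulaInvariantForm, Prop. 2.3] -/
theorem sum_classPolynomial_eval_zero_eq {κ : Type*} (S : Finset κ) (idx : κ → ι) {P : κ → ℂ[X]}
    {T₀ T₁ : κ → ℝ≥0} {A B : κ → ℂ}
    (hP : ∀ k ∈ S, ∀ T : ℝ≥0, T₀ k < T →
      truncatedTraceClass μ ν 𝓕 T cl (idx k) f = (P k).eval ((Real.log (T : ℝ) : ℝ) : ℂ))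
    (hrow : ∀ k ∈ S, ∀ T : ℝ≥0, T₁ k < T →
      truncatedTraceClass μ ν 𝓕 T cl (idx k) f = A k * ((Real.log (T : ℝ) : ℝ) : ℂ) + B k) :
    ∑ k ∈ S, (P k).eval 0 = ∑ k ∈ S, B k :=
  sum_polynomial_eval_zero_eq_sum_of_forall_eval_log_eq
    (J := fun k T => truncatedTraceClass μ ν 𝓕 T cl (idx k) f) S hP hrow

end Class

end UnitaryGroup

end Literature.NumberTheory.Automorphic
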